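import Summits.Ventures.Crystal3D.Theorems.StickyWulffConstantCoaxialWallLawTwoLatticeAdm
import Summits.Ventures.Crystal3D.Theorems.StickyWulffConstantCoaxialWallLawWordRootSeparation
import Summits.Ventures.Crystal3D.Theorems.StickyWulffConstantCoaxialWallLawWordRigidityMulti
import Literature.MathematicalPhysics.StatisticalMechanics.BarlowBilayers
import HarnessLib

/-!
# Reduced-word rigidity (root-free) and the basal partner of a word class
# (crux `CoaxialWallLaw`, stmt-Ventures-19481, line `WallLedgerF`; bricks of the (D4′) class collapse)

HONEST FRAMING. Venture `Summits/Ventures/Crystal3D` (cell `crystal3d-full`), helper `--supports` the crux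
`CoaxialWallLaw` of `route-Ventures-StickyWulffConstant` (REGISTERED line `WallLedgerF`, planner cf-p1).  Rung credit;
F-C1 not moved; census-free, no kissing facts.  cf-p1 ORDER OF RECORD for 19481-p2 g8 (2026-08-28T21:28:15Z) item (2),
lemma (D4′): the algebra consumed by `…ClassCollapse`.

* `reduced_forall₂_of_foldl_image_eq` — REDUCED-WORD RIGIDITY, root-free form of `word_eq_of_image_eq`: two reduced
  words of model `{111}` mirrors (unit model menu letters, consecutive letters at `±1/3`) with the same slot-dozen image
  are equal letter by letter up to sign (peel equal deepest mirrors; otherwise the glued word is a nonempty reduced word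
  mapping the slots onto themselves, impossible by `foldl_reflect_slots_false` = 3-adic non-return);
* `fw_apply_eq_foldl`, `image_fw_eq`, `foldl_image_eq_of_image_fw_eq`, `fw_eq_of_forall₂` — the base frame acts last;
* `wfChain_letters`, `wfChain_oblique`, `wfChain_letter_ne_axis` — letters of a well-formed chain (over a basal root:
  never `±e₃`);
* `basalMirror_map`, **`image_basalMirror_fw`** — `M_b ∘ G = G ∘ R_n` with `n = G⁻¹ e₃`: the BASAL PARTNER of the class
  `κ` has the slot dozen of the class `n :: κ`; `fw_cons_cons_of_sign` (equal letters cancel), `isChain_cons_of_ne`,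
  `std_cases` (two standard dozens are equal or basal mirror images).
WHAT THIS IS NOT: not the collapse itself (next file); F-C1 not moved.
-/

noncomputable section

namespace Summit.Ventures.Crystal3D.Theorems

open Summit.Ventures.Crystal3D Finset
open Literature.MathematicalPhysics.StatisticalMechanics (basalMirror basalMirror_apply_coord basalMirror_basalMirror)
open scoped InnerProductSpace

/-! ### Reduced-word rigidity (root-free) -/

section Rigidity

/-- Two letters equal up to sign give the same mirror step. -/
theorem reflectStep_congr {y μ μ' : EuclideanSpace ℝ (Fin 3)} (h : μ = μ' ∨ μ = -μ') :
    y - (2 * ⟪y, μ⟫_ℝ) • μ = y - (2 * ⟪y, μ'⟫_ℝ) • μ' := by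
  rcases h with rfl | rfl
  · rfl
  · exact reflect_neg_eq y μ'

/-- Words equal letter by letter up to sign act identically. -/
theorem foldl_eq_of_forall₂ :
    ∀ {κ κ' : List (EuclideanSpace ℝ (Fin 3))}, List.Forall₂ (fun a b => a = b ∨ a = -b) κ κ' →
      ∀ x : EuclideanSpace ℝ (Fin 3),
        κ.foldl (fun (y : EuclideanSpace ℝ (Fin 3)) μ => y - (2 * ⟪y, μ⟫_ℝ) • μ) x =
          κ'.foldl (fun (y : EuclideanSpace ℝ (Fin 3)) μ => y - (2 * ⟪y, μ⟫_ℝ) • μ) x := by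
  intro κ κ' h
  induction h with
  | nil => intro x; rfl
  | cons hab _ ih => intro x; rw [List.foldl_cons, List.foldl_cons, reflectStep_congr hab, ih]

/-- **REDUCED-WORD RIGIDITY.**  Two reduced words of model `{111}` mirrors with the same slot-dozen image are equal
letter by letter up to sign. -/
theorem reduced_forall₂_of_foldl_image_eq :
    ∀ (κ κ' : List (EuclideanSpace ℝ (Fin 3))),
      (∀ μ ∈ κ, ‖μ‖ = 1 ∧
        ∀ w ∈ fccSlots, ⟪w, μ⟫_ℝ = 0 ∨ ⟪w, μ⟫_ℝ = Real.sqrt (2 / 3) ∨ ⟪w, μ⟫_ℝ = -Real.sqrt (2 / 3)) →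
      (∀ μ ∈ κ', ‖μ‖ = 1 ∧
        ∀ w ∈ fccSlots, ⟪w, μ⟫_ℝ = 0 ∨ ⟪w, μ⟫_ℝ = Real.sqrt (2 / 3) ∨ ⟪w, μ⟫_ℝ = -Real.sqrt (2 / 3)) →
      List.IsChain (fun μ μ' => ⟪μ, μ'⟫_ℝ = 1 / 3 ∨ ⟪μ, μ'⟫_ℝ = -1 / 3) κ →
      List.IsChain (fun μ μ' => ⟪μ, μ'⟫_ℝ = 1 / 3 ∨ ⟪μ, μ'⟫_ℝ = -1 / 3) κ' →
      (fun x => κ.foldl (fun (y : EuclideanSpace ℝ (Fin 3)) μ => y - (2 * ⟪y, μ⟫_ℝ) • μ) x) '' (↑fccSlots : Set _) =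
        (fun x => κ'.foldl (fun (y : EuclideanSpace ℝ (Fin 3)) μ => y - (2 * ⟪y, μ⟫_ℝ) • μ) x) '' ↑fccSlots →
      List.Forall₂ (fun a b => a = b ∨ a = -b) κ κ' := by
  -- (0) a nonempty reduced word never maps the slot dozen onto itself
  have nonret : ∀ (κ : List (EuclideanSpace ℝ (Fin 3))), κ ≠ [] →
      (∀ μ ∈ κ, ‖μ‖ = 1 ∧
        ∀ w ∈ fccSlots, ⟪w, μ⟫_ℝ = 0 ∨ ⟪w, μ⟫_ℝ = Real.sqrt (2 / 3) ∨ ⟪w, μ⟫_ℝ = -Real.sqrt (2 / 3)) →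
      List.IsChain (fun μ μ' => ⟪μ, μ'⟫_ℝ = 1 / 3 ∨ ⟪μ, μ'⟫_ℝ = -1 / 3) κ →
      (fun x => κ.foldl (fun (y : EuclideanSpace ℝ (Fin 3)) μ => y - (2 * ⟪y, μ⟫_ℝ) • μ) x) '' (↑fccSlots : Set _) =
        ↑fccSlots → False := by
    intro κ hne hlet hch himg
    refine foldl_reflect_slots_false κ hne hlet hch fun w hw => ?_
    have : κ.foldl (fun (y : EuclideanSpace ℝ (Fin 3)) μ => y - (2 * ⟪y, μ⟫_ℝ) • μ) w ∈
        (fun x => κ.foldl (fun (y : EuclideanSpace ℝ (Fin 3)) μ => y - (2 * ⟪y, μ⟫_ℝ) • μ) x) '' (↑fccSlots : Set _) :=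
      Set.mem_image_of_mem _ (mem_coe.2 hw)
    rw [himg] at this
    exact mem_coe.1 this
  -- (1) the glued word of two reduced words whose deepest letters are not `±`-equal is reduced and returns: absurd
  have glue : ∀ (α α' : List (EuclideanSpace ℝ (Fin 3))) (x y : EuclideanSpace ℝ (Fin 3)),
      (∀ μ ∈ α ++ [x], ‖μ‖ = 1 ∧
        ∀ w ∈ fccSlots, ⟪w, μ⟫_ℝ = 0 ∨ ⟪w, μ⟫_ℝ = Real.sqrt (2 / 3) ∨ ⟪w, μ⟫_ℝ = -Real.sqrt (2 / 3)) →
      (∀ μ ∈ α' ++ [y], ‖μ‖ = 1 ∧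
        ∀ w ∈ fccSlots, ⟪w, μ⟫_ℝ = 0 ∨ ⟪w, μ⟫_ℝ = Real.sqrt (2 / 3) ∨ ⟪w, μ⟫_ℝ = -Real.sqrt (2 / 3)) →
      List.IsChain (fun μ μ' => ⟪μ, μ'⟫_ℝ = 1 / 3 ∨ ⟪μ, μ'⟫_ℝ = -1 / 3) (α ++ [x]) →
      List.IsChain (fun μ μ' => ⟪μ, μ'⟫_ℝ = 1 / 3 ∨ ⟪μ, μ'⟫_ℝ = -1 / 3) (α' ++ [y]) →
      (fun w => (α ++ [x]).foldl (fun (z : EuclideanSpace ℝ (Fin 3)) μ => z - (2 * ⟪z, μ⟫_ℝ) • μ) w) ''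
          (↑fccSlots : Set _) =
        (fun w => (α' ++ [y]).foldl (fun (z : EuclideanSpace ℝ (Fin 3)) μ => z - (2 * ⟪z, μ⟫_ℝ) • μ) w) '' ↑fccSlots →
      x ≠ y → x ≠ -y → False := by
    intro α α' x y hlet hlet' hch hch' himg hxy hxy'
    have hx := hlet x (by simp)
    have hy := hlet' y (by simp)
    have hα'u : ∀ μ ∈ α' ++ [y], ‖μ‖ = 1 := fun μ hμ => (hlet' μ hμ).1
    refine foldl_reflect_slots_false ((α ++ [x]) ++ (α' ++ [y]).reverse) (by simp) ?_ ?_ ?_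
    · intro μ hμ
      rcases List.mem_append.1 hμ with h | h
      · exact hlet μ h
      · exact hlet' μ (List.mem_reverse.1 h)
    · rw [List.isChain_append]
      refine ⟨hch, ?_, ?_⟩
      · rw [List.isChain_reverse]
        exact hch'.imp fun a b h => by rw [real_inner_comm]; exact h
      · intro a ha b hb
        rw [List.getLast?_concat] at ha
        rw [List.reverse_append, List.reverse_singleton, List.singleton_append, List.head?_cons] at hb
        simp only [Option.mem_def, Option.some.injEq] at ha hb
        subst ha; subst hb
        have hmx : ∀ w ∈ fccSlots,
            ⟪(LinearIsometryEquiv.refl ℝ (EuclideanSpace ℝ (Fin 3))) w, x⟫_ℝ = 0 ∨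
            ⟪(LinearIsometryEquiv.refl ℝ (EuclideanSpace ℝ (Fin 3))) w, x⟫_ℝ = Real.sqrt (2 / 3) ∨
            ⟪(LinearIsometryEquiv.refl ℝ (EuclideanSpace ℝ (Fin 3))) w, x⟫_ℝ = -Real.sqrt (2 / 3) := by
          intro w hw; simpa using hx.2 w hw
        have hmy : ∀ w ∈ fccSlots,
            ⟪(LinearIsometryEquiv.refl ℝ (EuclideanSpace ℝ (Fin 3))) w, y⟫_ℝ = 0 ∨
            ⟪(LinearIsometryEquiv.refl ℝ (EuclideanSpace ℝ (Fin 3))) w, y⟫_ℝ = Real.sqrt (2 / 3) ∨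
            ⟪(LinearIsometryEquiv.refl ℝ (EuclideanSpace ℝ (Fin 3))) w, y⟫_ℝ = -Real.sqrt (2 / 3) := by
          intro w hw; simpa using hy.2 w hw
        rcases inner_menuNormals (LinearIsometryEquiv.refl ℝ _) hx.1 hy.1 hmx hmy with h | h | h | h
        · exact absurd ((inner_eq_one_iff_of_norm_eq_one (𝕜 := ℝ) hx.1 hy.1).1 h) hxy
        · have hyx : y = -x := eq_neg_of_inner_eq_neg_one' hx.1 hy.1 h
          exact absurd (by rw [hyx, neg_neg]) hxy'
        · exact Or.inl h
        · exact Or.inr h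
    · intro w hw
      have hmem : (α ++ [x]).foldl (fun (z : EuclideanSpace ℝ (Fin 3)) μ => z - (2 * ⟪z, μ⟫_ℝ) • μ) w ∈
          (fun w => (α' ++ [y]).foldl (fun (z : EuclideanSpace ℝ (Fin 3)) μ => z - (2 * ⟪z, μ⟫_ℝ) • μ) w) ''
            (↑fccSlots : Set _) := by
        rw [← himg]; exact Set.mem_image_of_mem _ (mem_coe.2 hw)
      obtain ⟨w', hw', heq⟩ := hmem
      rw [List.foldl_append, ← heq, foldl_reflect_reverse_foldl _ hα'u]
      exact mem_coe.1 hw'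
  -- (2) induction on `κ` from the deep end
  intro κ
  induction κ using List.reverseRecOn with
  | nil =>
    intro κ' _ hlet' _ hch' himg
    cases κ' with
    | nil => exact List.Forall₂.nil
    | cons μ l =>
      exfalso
      refine nonret (μ :: l) (List.cons_ne_nil _ _) hlet' hch' ?_
      rw [← himg]; simp
  | append_singleton α x ih =>
    intro κ' hlet hlet' hch hch' himg
    induction κ' using List.reverseRecOn with
    | nil =>
      exfalso
      refine nonret (α ++ [x]) (by simp) hlet hch ?_
      rw [himg]; simp
    | append_singleton α' y _ =>
      by_cases hxy : x = y ∨ x = -y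
      · -- same deepest mirror: cancel it and recurse
        have hαl : ∀ μ ∈ α, ‖μ‖ = 1 ∧
            ∀ w ∈ fccSlots, ⟪w, μ⟫_ℝ = 0 ∨ ⟪w, μ⟫_ℝ = Real.sqrt (2 / 3) ∨ ⟪w, μ⟫_ℝ = -Real.sqrt (2 / 3) :=
          fun μ hμ => hlet μ (List.mem_append_left _ hμ)
        have hα'l : ∀ μ ∈ α', ‖μ‖ = 1 ∧
            ∀ w ∈ fccSlots, ⟪w, μ⟫_ℝ = 0 ∨ ⟪w, μ⟫_ℝ = Real.sqrt (2 / 3) ∨ ⟪w, μ⟫_ℝ = -Real.sqrt (2 / 3) :=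
          fun μ hμ => hlet' μ (List.mem_append_left _ hμ)
        have hy1 : ‖y‖ = 1 := (hlet' y (by simp)).1
        have himg' : (fun w => α.foldl (fun (z : EuclideanSpace ℝ (Fin 3)) μ => z - (2 * ⟪z, μ⟫_ℝ) • μ) w) ''
              (↑fccSlots : Set _) =
            (fun w => α'.foldl (fun (z : EuclideanSpace ℝ (Fin 3)) μ => z - (2 * ⟪z, μ⟫_ℝ) • μ) w) '' ↑fccSlots := by
          -- both images, pushed through the common deepest mirror `R_y`, agree; `R_y` is an involution
          have step : ∀ (β : List (EuclideanSpace ℝ (Fin 3))) (w : EuclideanSpace ℝ (Fin 3)),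
              (β ++ [y]).foldl (fun (z : EuclideanSpace ℝ (Fin 3)) μ => z - (2 * ⟪z, μ⟫_ℝ) • μ) w =
                (β.foldl (fun (z : EuclideanSpace ℝ (Fin 3)) μ => z - (2 * ⟪z, μ⟫_ℝ) • μ) w) -
                  (2 * ⟪β.foldl (fun (z : EuclideanSpace ℝ (Fin 3)) μ => z - (2 * ⟪z, μ⟫_ℝ) • μ) w, y⟫_ℝ) • y := by
            intro β w; rw [List.foldl_append, List.foldl_cons, List.foldl_nil]
          have hx_eq : ∀ w : EuclideanSpace ℝ (Fin 3),
              (α ++ [x]).foldl (fun (z : EuclideanSpace ℝ (Fin 3)) μ => z - (2 * ⟪z, μ⟫_ℝ) • μ) w =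
                (α ++ [y]).foldl (fun (z : EuclideanSpace ℝ (Fin 3)) μ => z - (2 * ⟪z, μ⟫_ℝ) • μ) w := by
            intro w
            rw [List.foldl_append, List.foldl_append, List.foldl_cons, List.foldl_nil, List.foldl_cons, List.foldl_nil,
              reflectStep_congr hxy]
          ext v
          constructor
          · rintro ⟨w, hw, rfl⟩
            have hmem : (α ++ [x]).foldl (fun (z : EuclideanSpace ℝ (Fin 3)) μ => z - (2 * ⟪z, μ⟫_ℝ) • μ) w ∈
                (fun w => (α' ++ [y]).foldl (fun (z : EuclideanSpace ℝ (Fin 3)) μ => z - (2 * ⟪z, μ⟫_ℝ) • μ) w) ''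
                  (↑fccSlots : Set _) := by
              rw [← himg]; exact Set.mem_image_of_mem _ hw
            obtain ⟨w', hw', heq⟩ := hmem
            refine ⟨w', hw', ?_⟩
            dsimp only at heq
            rw [hx_eq, step, step] at heq
            have := congrArg (fun z => z - (2 * ⟪z, y⟫_ℝ) • y) heq
            simp only [reflect_reflect_unit hy1] at this
            exact this
          · rintro ⟨w', hw', rfl⟩
            have hmem : (α' ++ [y]).foldl (fun (z : EuclideanSpace ℝ (Fin 3)) μ => z - (2 * ⟪z, μ⟫_ℝ) • μ) w' ∈
                (fun w => (α ++ [x]).foldl (fun (z : EuclideanSpace ℝ (Fin 3)) μ => z - (2 * ⟪z, μ⟫_ℝ) • μ) w) ''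
                  (↑fccSlots : Set _) := by
              rw [himg]; exact Set.mem_image_of_mem _ hw'
            obtain ⟨w, hw, heq⟩ := hmem
            refine ⟨w, hw, ?_⟩
            dsimp only at heq
            rw [hx_eq, step, step] at heq
            have := congrArg (fun z => z - (2 * ⟪z, y⟫_ℝ) • y) heq
            simp only [reflect_reflect_unit hy1] at this
            exact this
        have hF := ih α' hαl hα'l hch.left_of_append hch'.left_of_append himg'
        exact List.rel_append hF (List.Forall₂.cons hxy List.Forall₂.nil)
      · push Not at hxy
        exact (glue α α' x y hlet hlet' hch hch' himg hxy.1 hxy.2).elim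

end Rigidity

/-! ### Frames of words: the base frame acts last -/

section Frames

/-- `S.Fw κ x = S.G₀ (foldl R κ x)` for unit letters. -/
theorem fw_apply_eq_foldl (S : PlateSystem) {κ : List (EuclideanSpace ℝ (Fin 3))} (hunit : ∀ μ ∈ κ, ‖μ‖ = 1)
    (x : EuclideanSpace ℝ (Fin 3)) :
    S.Fw κ x = S.G₀ (κ.foldl (fun (y : EuclideanSpace ℝ (Fin 3)) μ => y - (2 * ⟪y, μ⟫_ℝ) • μ) x) := by
  have h := word_F_append_apply (F := S.Fw) (PlateSystem.fw_cons S) κ hunit [] x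
  rw [List.append_nil] at h
  exact h

/-- The slot-dozen image of a word frame. -/
theorem image_fw_eq (S : PlateSystem) {κ : List (EuclideanSpace ℝ (Fin 3))} (hunit : ∀ μ ∈ κ, ‖μ‖ = 1) :
    (S.Fw κ : EuclideanSpace ℝ (Fin 3) → EuclideanSpace ℝ (Fin 3)) '' ↑fccSlots =
      (S.G₀ : EuclideanSpace ℝ (Fin 3) → EuclideanSpace ℝ (Fin 3)) ''
        ((fun x => κ.foldl (fun (y : EuclideanSpace ℝ (Fin 3)) μ => y - (2 * ⟪y, μ⟫_ℝ) • μ) x) '' ↑fccSlots) := by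
  rw [Set.image_image]
  exact Set.image_congr fun x _ => fw_apply_eq_foldl S hunit x

/-- Equal frame images give equal model-side images. -/
theorem foldl_image_eq_of_image_fw_eq (S : PlateSystem) {κ κ' : List (EuclideanSpace ℝ (Fin 3))}
    (hunit : ∀ μ ∈ κ, ‖μ‖ = 1) (hunit' : ∀ μ ∈ κ', ‖μ‖ = 1)
    (h : (S.Fw κ : EuclideanSpace ℝ (Fin 3) → EuclideanSpace ℝ (Fin 3)) '' ↑fccSlots =
      (S.Fw κ' : EuclideanSpace ℝ (Fin 3) → EuclideanSpace ℝ (Fin 3)) '' ↑fccSlots) :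
    (fun x => κ.foldl (fun (y : EuclideanSpace ℝ (Fin 3)) μ => y - (2 * ⟪y, μ⟫_ℝ) • μ) x) '' (↑fccSlots : Set _) =
      (fun x => κ'.foldl (fun (y : EuclideanSpace ℝ (Fin 3)) μ => y - (2 * ⟪y, μ⟫_ℝ) • μ) x) '' ↑fccSlots := by
  rw [image_fw_eq S hunit, image_fw_eq S hunit'] at h
  exact (Set.image_injective.2 S.G₀.injective) h

/-- Words equal up to letter signs have the same frame. -/
theorem fw_eq_of_forall₂ (S : PlateSystem) {κ κ' : List (EuclideanSpace ℝ (Fin 3))}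
    (h : List.Forall₂ (fun a b => a = b ∨ a = -b) κ κ') (hunit : ∀ μ ∈ κ, ‖μ‖ = 1) (hunit' : ∀ μ ∈ κ', ‖μ‖ = 1) :
    S.Fw κ = S.Fw κ' :=
  LinearIsometryEquiv.ext fun x => by rw [fw_apply_eq_foldl S hunit, fw_apply_eq_foldl S hunit', foldl_eq_of_forall₂ h]

/-- Letters and reducedness of a well-formed chain. -/
theorem wfChain_letters {r : EuclideanSpace ℝ (Fin 3)} {κ : List (EuclideanSpace ℝ (Fin 3))} (h : WFChain r κ) :
    (∀ μ ∈ κ, ‖μ‖ = 1 ∧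
      ∀ w ∈ fccSlots, ⟪w, μ⟫_ℝ = 0 ∨ ⟪w, μ⟫_ℝ = Real.sqrt (2 / 3) ∨ ⟪w, μ⟫_ℝ = -Real.sqrt (2 / 3)) ∧
    List.IsChain (fun μ μ' => ⟪μ, μ'⟫_ℝ = 1 / 3 ∨ ⟪μ, μ'⟫_ℝ = -1 / 3) κ :=
  word_letters_of_wf (u := fun κ => ((-1 : ℝ) ^ κ.length) • r) (WF := WFChain r) (PlateSystem.u_cons r)
    (PlateSystem.wfChain_cons r) κ h

/-- Every letter of a well-formed chain is oblique to the root. -/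
theorem wfChain_oblique {r : EuclideanSpace ℝ (Fin 3)} {κ : List (EuclideanSpace ℝ (Fin 3))} (h : WFChain r κ) :
    ∀ μ ∈ κ, ⟪r, μ⟫_ℝ = Real.sqrt (2 / 3) ∨ ⟪r, μ⟫_ℝ = -Real.sqrt (2 / 3) := by
  have key := word_letters_oblique_of_wf (u := fun κ => ((-1 : ℝ) ^ κ.length) • r) (WF := WFChain r)
    (PlateSystem.u_cons r) (PlateSystem.wfChain_cons r) κ h
  simpa using key

/-- A chain from a BASAL root has no letter `±e₃`. -/
theorem wfChain_letter_ne_axis {r : EuclideanSpace ℝ (Fin 3)} (hr2 : r 2 = 0) {κ : List (EuclideanSpace ℝ (Fin 3))}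
    (h : WFChain r κ) {μ : EuclideanSpace ℝ (Fin 3)} (hμ : μ ∈ κ) :
    μ ≠ EuclideanSpace.single (2 : Fin 3) (1 : ℝ) ∧ μ ≠ -EuclideanSpace.single (2 : Fin 3) (1 : ℝ) := by
  have hr : 0 < Real.sqrt (2 / 3) := Real.sqrt_pos.2 (by norm_num)
  have h0 : ⟪r, EuclideanSpace.single (2 : Fin 3) (1 : ℝ)⟫_ℝ = 0 := by rw [inner_single_two_one, hr2]
  constructor
  · rintro rfl
    rcases wfChain_oblique h _ hμ with h1 | h1 <;> rw [h0] at h1 <;> linarith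
  · rintro rfl
    rcases wfChain_oblique h _ hμ with h1 | h1 <;> rw [inner_neg_right, h0] at h1 <;> linarith

/-- The basal mirror as a unit reflection. -/
theorem basalMirror_apply_eq (x : EuclideanSpace ℝ (Fin 3)) :
    basalMirror x = x - (2 * ⟪x, EuclideanSpace.single (2 : Fin 3) (1 : ℝ)⟫_ℝ) • EuclideanSpace.single (2 : Fin 3) (1 : ℝ) := by
  have he : ‖EuclideanSpace.single (2 : Fin 3) (1 : ℝ)‖ = 1 := by rw [PiLp.norm_single, norm_one]
  exact reflection_unit_apply he x

/-- **Conjugation**: `M_b (G x) = G (R_n x)` with `n = G⁻¹ e₃`. -/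
theorem basalMirror_map (G : EuclideanSpace ℝ (Fin 3) ≃ₗᵢ[ℝ] EuclideanSpace ℝ (Fin 3)) (x : EuclideanSpace ℝ (Fin 3)) :
    basalMirror (G x) =
      G (x - (2 * ⟪x, G.symm (EuclideanSpace.single (2 : Fin 3) (1 : ℝ))⟫_ℝ) •
        G.symm (EuclideanSpace.single (2 : Fin 3) (1 : ℝ))) := by
  rw [basalMirror_apply_eq, map_sub, LinearIsometryEquiv.map_smul, LinearIsometryEquiv.apply_symm_apply,
    ← LinearIsometryEquiv.inner_map_map G x, LinearIsometryEquiv.apply_symm_apply]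

/-- The pulled-back axis `n = (S.Fw κ)⁻¹ e₃` is a unit vector. -/
theorem norm_symm_axis (G : EuclideanSpace ℝ (Fin 3) ≃ₗᵢ[ℝ] EuclideanSpace ℝ (Fin 3)) :
    ‖G.symm (EuclideanSpace.single (2 : Fin 3) (1 : ℝ))‖ = 1 := by
  rw [LinearIsometryEquiv.norm_map, PiLp.norm_single, norm_one]

/-- **The basal partner of a class is the class with one more letter**: `M_b '' img (S.Fw κ) = img (S.Fw (n :: κ))`,
`n = (S.Fw κ)⁻¹ e₃`. -/
theorem image_basalMirror_fw (S : PlateSystem) (κ : List (EuclideanSpace ℝ (Fin 3))) :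
    (basalMirror : EuclideanSpace ℝ (Fin 3) → EuclideanSpace ℝ (Fin 3)) ''
        ((S.Fw κ : EuclideanSpace ℝ (Fin 3) → EuclideanSpace ℝ (Fin 3)) '' ↑fccSlots) =
      (S.Fw ((S.Fw κ).symm (EuclideanSpace.single (2 : Fin 3) (1 : ℝ)) :: κ) :
        EuclideanSpace ℝ (Fin 3) → EuclideanSpace ℝ (Fin 3)) '' ↑fccSlots := by
  have hn := norm_symm_axis (S.Fw κ)
  rw [Set.image_image]
  refine Set.image_congr fun w _ => ?_
  rw [word_F_cons_apply (PlateSystem.fw_cons S) hn, basalMirror_map]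

/-- Two consecutive letters equal up to sign cancel. -/
theorem fw_cons_cons_of_sign (S : PlateSystem) {n μ : EuclideanSpace ℝ (Fin 3)} (κ : List (EuclideanSpace ℝ (Fin 3)))
    (h : n = μ ∨ n = -μ) (hμ : ‖μ‖ = 1) : S.Fw (n :: μ :: κ) = S.Fw κ := by
  have hn : ‖n‖ = 1 := by rcases h with rfl | rfl <;> simp [hμ]
  refine LinearIsometryEquiv.ext fun x => ?_
  rw [word_F_cons_apply (PlateSystem.fw_cons S) hn, word_F_cons_apply (PlateSystem.fw_cons S) hμ,
    reflectStep_congr (y := x) h, reflect_reflect_unit hμ]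

/-- Prepending a menu letter that is not `±` the head keeps a word reduced. -/
theorem isChain_cons_of_ne {n : EuclideanSpace ℝ (Fin 3)} {κ : List (EuclideanSpace ℝ (Fin 3))}
    (hn : ‖n‖ = 1 ∧ ∀ w ∈ fccSlots, ⟪w, n⟫_ℝ = 0 ∨ ⟪w, n⟫_ℝ = Real.sqrt (2 / 3) ∨ ⟪w, n⟫_ℝ = -Real.sqrt (2 / 3))
    (hlet : ∀ μ ∈ κ, ‖μ‖ = 1 ∧
      ∀ w ∈ fccSlots, ⟪w, μ⟫_ℝ = 0 ∨ ⟪w, μ⟫_ℝ = Real.sqrt (2 / 3) ∨ ⟪w, μ⟫_ℝ = -Real.sqrt (2 / 3))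
    (hch : List.IsChain (fun μ μ' => ⟪μ, μ'⟫_ℝ = 1 / 3 ∨ ⟪μ, μ'⟫_ℝ = -1 / 3) κ)
    (hne : ∀ μ, κ.head? = some μ → n ≠ μ ∧ n ≠ -μ) :
    List.IsChain (fun μ μ' => ⟪μ, μ'⟫_ℝ = 1 / 3 ∨ ⟪μ, μ'⟫_ℝ = -1 / 3) (n :: κ) := by
  rw [List.isChain_cons]
  refine ⟨fun μ hμ => ?_, hch⟩
  have hμκ : μ ∈ κ := List.mem_of_mem_head? hμ
  obtain ⟨hμ1, hμm⟩ := hlet μ hμκ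
  obtain ⟨h1, h2⟩ := hne μ hμ
  have hmx : ∀ w ∈ fccSlots,
      ⟪(LinearIsometryEquiv.refl ℝ (EuclideanSpace ℝ (Fin 3))) w, n⟫_ℝ = 0 ∨
      ⟪(LinearIsometryEquiv.refl ℝ (EuclideanSpace ℝ (Fin 3))) w, n⟫_ℝ = Real.sqrt (2 / 3) ∨
      ⟪(LinearIsometryEquiv.refl ℝ (EuclideanSpace ℝ (Fin 3))) w, n⟫_ℝ = -Real.sqrt (2 / 3) := by
    intro w hw; simpa using hn.2 w hw
  have hmy : ∀ w ∈ fccSlots,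
      ⟪(LinearIsometryEquiv.refl ℝ (EuclideanSpace ℝ (Fin 3))) w, μ⟫_ℝ = 0 ∨
      ⟪(LinearIsometryEquiv.refl ℝ (EuclideanSpace ℝ (Fin 3))) w, μ⟫_ℝ = Real.sqrt (2 / 3) ∨
      ⟪(LinearIsometryEquiv.refl ℝ (EuclideanSpace ℝ (Fin 3))) w, μ⟫_ℝ = -Real.sqrt (2 / 3) := by
    intro w hw; simpa using hμm w hw
  rcases inner_menuNormals (LinearIsometryEquiv.refl ℝ _) hn.1 hμ1 hmx hmy with h | h | h | h
  · exact absurd ((inner_eq_one_iff_of_norm_eq_one (𝕜 := ℝ) hn.1 hμ1).1 h) h1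
  · exact absurd (eq_neg_of_inner_eq_neg_one' hn.1 hμ1 h ▸ (neg_neg n).symm) h2
  · exact Or.inl h
  · exact Or.inr h

/-- **Standard dozens**: if `img G` and `img G'` are both `D₊` or `D₋`, then `img G' = img G` or `= M_b '' img G`. -/
theorem std_cases {G G' : EuclideanSpace ℝ (Fin 3) ≃ₗᵢ[ℝ] EuclideanSpace ℝ (Fin 3)}
    (hG : (G : EuclideanSpace ℝ (Fin 3) → EuclideanSpace ℝ (Fin 3)) '' ↑fccSlots = ↑fccSlots ∨
      (G : EuclideanSpace ℝ (Fin 3) → EuclideanSpace ℝ (Fin 3)) '' ↑fccSlots =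
        (basalMirror : EuclideanSpace ℝ (Fin 3) → EuclideanSpace ℝ (Fin 3)) '' ↑fccSlots)
    (hG' : (G' : EuclideanSpace ℝ (Fin 3) → EuclideanSpace ℝ (Fin 3)) '' ↑fccSlots = ↑fccSlots ∨
      (G' : EuclideanSpace ℝ (Fin 3) → EuclideanSpace ℝ (Fin 3)) '' ↑fccSlots =
        (basalMirror : EuclideanSpace ℝ (Fin 3) → EuclideanSpace ℝ (Fin 3)) '' ↑fccSlots) :
    (G' : EuclideanSpace ℝ (Fin 3) → EuclideanSpace ℝ (Fin 3)) '' ↑fccSlots =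
        (G : EuclideanSpace ℝ (Fin 3) → EuclideanSpace ℝ (Fin 3)) '' ↑fccSlots ∨
      (G' : EuclideanSpace ℝ (Fin 3) → EuclideanSpace ℝ (Fin 3)) '' ↑fccSlots =
        (basalMirror : EuclideanSpace ℝ (Fin 3) → EuclideanSpace ℝ (Fin 3)) ''
          ((G : EuclideanSpace ℝ (Fin 3) → EuclideanSpace ℝ (Fin 3)) '' ↑fccSlots) := by
  have hMM : (basalMirror : EuclideanSpace ℝ (Fin 3) → EuclideanSpace ℝ (Fin 3)) ''
      ((basalMirror : EuclideanSpace ℝ (Fin 3) → EuclideanSpace ℝ (Fin 3)) '' ↑fccSlots) = ↑fccSlots := by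
    rw [Set.image_image]
    simp [basalMirror_basalMirror]
  rcases hG with hG | hG <;> rcases hG' with hG' | hG'
  · exact Or.inl (hG'.trans hG.symm)
  · exact Or.inr (by rw [hG', hG])
  · exact Or.inr (by rw [hG', hG, hMM])
  · exact Or.inl (hG'.trans hG.symm)

end Frames

end Summit.Ventures.Crystal3D.Theorems

end
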